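import Summits.NavierStokesRegularity.FunctionalMining.StretchingLaminateBurkholderDefs
import Mathlib.Topology.Piecewise
import Mathlib.Topology.Order.OrderClosed
import Mathlib.Tactic.Linarith
import Mathlib.Tactic.FunProp
import HarnessLib

/-!
# FunctionalMining — K1-Q1 laminates, L-CAP-B kernel port (2): continuity of Burkholder's profile and the `σ → 1⁻` limits

search for candidate a priori estimates; no regularity claim.

Cell `pub-nsfunc` (host summit NavierStokesRegularity, topic `FunctionalMining`), prove seat gen 7.  Part of the
kernel port of the bank seat's THEOREM L-CAP-B (`HOME/pub-nsfunc-bank/K1Q1-LAMINATE-BURKHOLDER.md` §1–§3, §7–§8; dict typing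
notes 134/134a): `Burkholder1991_keyFunction → C_lam ≤ 49/50`, a cap on the laminate METHOD for the stretching constant
(`C_lam = laminateSupConst`), CONDITIONAL on the vendored Literature named fact `Burkholder1991_keyFunction` (Burkholder 1991,
LNM 1464, §8: the key function `u_λ` of Thm 8.1; only its CONCAVITY clause is used, always as an explicit hypothesis `hBK`).
Nothing in this file is a statement about Navier–Stokes solutions, and `C⋆ = stretchingSupConst` is not touched.

THIS FILE (pure real analysis of the printed closed forms; no named fact used): the interior cascade `Burk.uCore λ` is
CONTINUOUS on `{0 ≤ r < 1, z > −1}` (four applications of `ContinuousOn.if`: the five pieces glue along `z² = λ²−1+r²`,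
`z = λ−1±r`, `r+z = 1`, using `2αe^{−2} = ½`); along the scaling path `σ ↦ (σr, σ²z)` every leaf value is recovered as
`σ → 1⁻` up to any `δ > 0` (`uProf_path_eventually_ge`): interior leaves by continuity, sphere leaves with `z < λ` trivially
(`u ≥ 0`), `z > λ` through `D₄` (`u = 1` eventually), and the corner `z = λ` through `D₂`, where
`uProf λ σ (σ²λ) = 1/(λ²(1−σ²)+1) → 1` (`uProf_corner`).  This is the limit step of the tree inequality `(TB)` (file
`…BurkholderTree`), which is first proved for the SCALED embedding where the concavity clause applies with STRICT
subordination.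
-/

noncomputable section

namespace Summit.NavierStokesRegularity.FunctionalMining

namespace Burk

open Literature.Probability.Process Filter Topology Set

/-- `2α e^{−2} = 1/2` (`α = e²/4`). [ours; bookkeeping] -/
theorem two_alpha_exp_neg_two : 2 * burkholderAlpha * Real.exp (-2) = 1 / 2 := by
  unfold burkholderAlpha
  rw [Real.exp_neg]
  have h : Real.exp 2 ≠ 0 := (Real.exp_pos 2).ne'
  field_simp
  norm_num

/-- The admissible region of the limit argument: `0 ≤ r < 1`, `z > −1` (the interior cascade `uCore` is continuous
there; it is NOT continuous for `r < 0` or very negative `z`, which never occur). [ours; bookkeeping] -/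
theorem continuousOn_uCore {lam : ℝ} (hlam : 2 < lam) :
    ContinuousOn (uCore lam) {p : ℝ × ℝ | 0 ≤ p.1 ∧ p.1 < 1 ∧ -1 < p.2} := by
  set U : Set (ℝ × ℝ) := {p : ℝ × ℝ | 0 ≤ p.1 ∧ p.1 < 1 ∧ -1 < p.2} with hU
  have hl1 : 0 < lam - 1 := by linarith
  -- the five pieces
  have c1 : Continuous fun p : ℝ × ℝ => p.1 := continuous_fst
  have c2 : Continuous fun p : ℝ × ℝ => p.2 := continuous_snd
  have f2c : Continuous fun p : ℝ × ℝ => 1 - (lam ^ 2 - 1 - p.2 ^ 2 + p.1 ^ 2) / (4 * (lam - 1)) := by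
    fun_prop
  have f3c : ContinuousOn (fun p : ℝ × ℝ => (1 - p.1 ^ 2) / ((lam - p.2) ^ 2 + 1 - p.1 ^ 2)) U := by
    apply ContinuousOn.div (by fun_prop) (by fun_prop)
    intro p hp
    have h1 : p.1 ^ 2 < 1 := by
      have := hp.1; have := hp.2.1; nlinarith
    nlinarith [sq_nonneg (lam - p.2)]
  have f4c : Continuous fun p : ℝ × ℝ => 2 * burkholderAlpha * (1 - p.1) * Real.exp (p.1 + p.2 - lam - 1) := by
    fun_prop
  have f5c : Continuous fun p : ℝ × ℝ => burkholderAlpha * (1 + p.2 ^ 2 - p.1 ^ 2) * Real.exp (-lam) := by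
    fun_prop
  -- level 4: D₁ / D₀
  have L4 : ContinuousOn (fun p : ℝ × ℝ => if 1 ≤ p.1 + p.2 then
      2 * burkholderAlpha * (1 - p.1) * Real.exp (p.1 + p.2 - lam - 1)
      else burkholderAlpha * (1 + p.2 ^ 2 - p.1 ^ 2) * Real.exp (-lam)) U := by
    refine ContinuousOn.if ?_ f4c.continuousOn f5c.continuousOn
    rintro a ⟨_, ha⟩
    have he : (1 : ℝ) = a.1 + a.2 :=
      frontier_le_subset_eq continuous_const (c1.add c2) ha
    rw [show a.1 + a.2 - lam - 1 = -lam by linarith, show a.2 = 1 - a.1 by linarith]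
    ring
  -- level 3: D₂ / below
  have L3 : ContinuousOn (fun p : ℝ × ℝ => if lam - 1 - p.1 ≤ p.2 then
      (1 - p.1 ^ 2) / ((lam - p.2) ^ 2 + 1 - p.1 ^ 2)
      else if 1 ≤ p.1 + p.2 then 2 * burkholderAlpha * (1 - p.1) * Real.exp (p.1 + p.2 - lam - 1)
      else burkholderAlpha * (1 + p.2 ^ 2 - p.1 ^ 2) * Real.exp (-lam)) U := by
    refine ContinuousOn.if ?_ (f3c.mono inter_subset_left) (L4.mono inter_subset_left)
    rintro a ⟨haU, ha⟩
    have he : lam - 1 - a.1 = a.2 :=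
      frontier_le_subset_eq (by fun_prop) c2 ha
    have ha0 : 0 ≤ a.1 := haU.1
    have ha1 : a.1 < 1 := haU.2.1
    rw [if_pos (by linarith), show a.1 + a.2 - lam - 1 = -2 by linarith, ← he]
    have hden : (lam - (lam - 1 - a.1)) ^ 2 + 1 - a.1 ^ 2 = 2 * (1 + a.1) := by ring
    rw [hden]
    have h12 : (1 + a.1) ≠ 0 := by linarith
    have key : (1 - a.1 ^ 2) / (2 * (1 + a.1)) = (1 - a.1) / 2 := by
      field_simp; ring
    rw [key]
    have := two_alpha_exp_neg_two
    calc (1 - a.1) / 2 = (1 - a.1) * (2 * burkholderAlpha * Real.exp (-2)) := by rw [this]; ring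
      _ = 2 * burkholderAlpha * (1 - a.1) * Real.exp (-2) := by ring
  -- level 2: D₃ / below
  have L2 : ContinuousOn (fun p : ℝ × ℝ => if lam - 1 + p.1 ≤ p.2 then
      1 - (lam ^ 2 - 1 - p.2 ^ 2 + p.1 ^ 2) / (4 * (lam - 1))
      else if lam - 1 - p.1 ≤ p.2 then (1 - p.1 ^ 2) / ((lam - p.2) ^ 2 + 1 - p.1 ^ 2)
      else if 1 ≤ p.1 + p.2 then 2 * burkholderAlpha * (1 - p.1) * Real.exp (p.1 + p.2 - lam - 1)
      else burkholderAlpha * (1 + p.2 ^ 2 - p.1 ^ 2) * Real.exp (-lam)) U := by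
    refine ContinuousOn.if ?_ (f2c.continuousOn.mono inter_subset_left) (L3.mono inter_subset_left)
    rintro a ⟨haU, ha⟩
    have he : lam - 1 + a.1 = a.2 :=
      frontier_le_subset_eq (by fun_prop) c2 ha
    have ha0 : 0 ≤ a.1 := haU.1
    have ha1 : a.1 < 1 := haU.2.1
    rw [if_pos (by linarith), ← he]
    have hden : (lam - (lam - 1 + a.1)) ^ 2 + 1 - a.1 ^ 2 = 2 * (1 - a.1) := by ring
    rw [hden]
    have h12 : (1 - a.1) ≠ 0 := by linarith
    have hl4 : 4 * (lam - 1) ≠ 0 := by linarith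
    field_simp
    ring
  -- level 1: D₄ / below
  have L1 : ContinuousOn (uCore lam) U := by
    refine ContinuousOn.if ?_ continuousOn_const (L2.mono inter_subset_left)
    rintro a ⟨haU, ha⟩
    have he : lam ^ 2 - 1 + a.1 ^ 2 = a.2 ^ 2 :=
      frontier_lt_subset_eq (by fun_prop) (by fun_prop) ha
    have ha0 : 0 ≤ a.1 := haU.1
    have ha1 : a.1 < 1 := haU.2.1
    have hz1 : -1 < a.2 := haU.2.2
    -- `a.2 > 0` and `a.2 ≥ λ − 1 + a.1`
    have hz0 : 0 < a.2 := by
      by_contra hcon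
      have hle : a.2 ≤ 0 := not_lt.1 hcon
      nlinarith [mul_nonneg (neg_nonneg.2 hle) (by linarith : (0 : ℝ) ≤ a.2 + 1)]
    have hP2 : lam - 1 + a.1 ≤ a.2 := by
      have hsq : (lam - 1 + a.1) ^ 2 ≤ a.2 ^ 2 := by nlinarith
      have hnn : 0 ≤ lam - 1 + a.1 := by linarith
      by_contra hcon
      have hlt : a.2 < lam - 1 + a.1 := not_le.1 hcon
      nlinarith [mul_pos (by linarith : (0 : ℝ) < lam - 1 + a.1 - a.2) (by linarith : (0 : ℝ) < lam - 1 + a.1 + a.2)]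
    rw [if_pos hP2, ← he]
    field_simp
    ring
  exact L1

/-- The corner path through `D₂`: for `1 − 1/λ ≤ σ < 1` (`σ > 0`), `uProf λ σ (σ²λ) = 1/(λ²(1 − σ²) + 1)` (so it
tends to `1 = u_λ` at the sphere point `(1, λ)`, the pinch point of `D₃`). [ours; elementary] -/
theorem uProf_corner {lam σ : ℝ} (hlam : 2 < lam) (hσ0 : 0 < σ) (hσ1 : σ < 1) (hσ : 1 - 1 / lam ≤ σ) :
    uProf lam σ (σ ^ 2 * lam) = 1 / (lam ^ 2 * (1 - σ ^ 2) + 1) := by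
  have hl : 0 < lam := by linarith
  have hσ2 : σ ^ 2 < 1 := by nlinarith
  have hls : lam - 1 ≤ lam * σ := by
    have h1 : lam * (1 - 1 / lam) = lam - 1 := by field_simp
    have h2 := mul_le_mul_of_nonneg_left hσ hl.le
    linarith
  have h4 : ¬ (lam ^ 2 - 1 + σ ^ 2 < (σ ^ 2 * lam) ^ 2) := by
    have : (σ ^ 2 * lam) ^ 2 - (lam ^ 2 - 1 + σ ^ 2) = (σ ^ 2 - 1) * (lam ^ 2 * (σ ^ 2 + 1) - 1) := by ring
    have hneg : (σ ^ 2 - 1) * (lam ^ 2 * (σ ^ 2 + 1) - 1) < 0 :=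
      mul_neg_of_neg_of_pos (by linarith) (by nlinarith)
    linarith
  have h3 : ¬ (lam - 1 + σ ≤ σ ^ 2 * lam) := by
    have : σ ^ 2 * lam - (lam - 1 + σ) = (σ - 1) * (lam * (σ + 1) - 1) := by ring
    have hneg : (σ - 1) * (lam * (σ + 1) - 1) < 0 := mul_neg_of_neg_of_pos (by linarith) (by nlinarith)
    linarith
  have h2 : lam - 1 - σ ≤ σ ^ 2 * lam := by
    have : σ ^ 2 * lam - (lam - 1 - σ) = (σ + 1) * (lam * σ - lam + 1) := by ring
    have hnn : 0 ≤ (σ + 1) * (lam * σ - lam + 1) := mul_nonneg (by linarith) (by linarith)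
    linarith
  unfold uProf
  rw [if_neg hσ1.ne, if_neg h4, if_neg h3, if_pos h2]
  have hne : (lam - σ ^ 2 * lam) ^ 2 + 1 - σ ^ 2 = (1 - σ ^ 2) * (lam ^ 2 * (1 - σ ^ 2) + 1) := by ring
  rw [hne]
  have h1 : (1 - σ ^ 2) ≠ 0 := by linarith
  have h5 : lam ^ 2 * (1 - σ ^ 2) + 1 ≠ 0 := by nlinarith
  field_simp

/-- Along the scaling path the parameter is eventually in `(0, 1)`. [ours; bookkeeping] -/
theorem eventually_path_mem : ∀ᶠ σ in 𝓝[<] (1 : ℝ), 0 < σ ∧ σ < 1 := by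
  have h1 : ∀ᶠ σ in 𝓝[<] (1 : ℝ), σ < 1 := eventually_mem_nhdsWithin
  have h2 : ∀ᶠ σ in 𝓝[<] (1 : ℝ), 0 < σ := (eventually_gt_nhds zero_lt_one).filter_mono nhdsWithin_le_nhds
  exact h2.and h1

/-- **Interior leaves: continuity along the scaling path.** For `0 ≤ r < 1`, `0 ≤ z`:
`uProf λ (σr) (σ²z) → uProf λ r z` as `σ → 1⁻`. [ours; elementary] -/
theorem tendsto_uProf_path {lam r z : ℝ} (hlam : 2 < lam) (hr0 : 0 ≤ r) (hr1 : r < 1) (hz : 0 ≤ z) :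
    Tendsto (fun σ : ℝ => uProf lam (σ * r) (σ ^ 2 * z)) (𝓝[<] 1) (𝓝 (uProf lam r z)) := by
  set U : Set (ℝ × ℝ) := {p : ℝ × ℝ | 0 ≤ p.1 ∧ p.1 < 1 ∧ -1 < p.2} with hU
  have hmem : (r, z) ∈ U := ⟨hr0, hr1, by linarith⟩
  have hc : ContinuousWithinAt (uCore lam) U (r, z) := continuousOn_uCore hlam _ hmem
  have hφ : Tendsto (fun σ : ℝ => (σ * r, σ ^ 2 * z)) (𝓝[<] (1 : ℝ)) (𝓝[U] (r, z)) := by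
    refine tendsto_nhdsWithin_iff.2 ⟨?_, ?_⟩
    · have hcont : Continuous (fun σ : ℝ => (σ * r, σ ^ 2 * z)) := by fun_prop
      have h1 := hcont.tendsto 1
      simp only [one_mul, one_pow] at h1
      exact h1.mono_left nhdsWithin_le_nhds
    · filter_upwards [eventually_path_mem] with σ ⟨h0, h1⟩
      refine ⟨by positivity, ?_, ?_⟩
      · show σ * r < 1
        calc σ * r ≤ σ * 1 := mul_le_mul_of_nonneg_left hr1.le h0.le
          _ < 1 := by linarith
      · show -1 < σ ^ 2 * z
        nlinarith [sq_nonneg σ]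
  have hcomp := hc.tendsto.comp hφ
  rw [uProf_eq_uCore hr1.ne]
  refine Tendsto.congr' ?_ hcomp
  filter_upwards [eventually_path_mem] with σ ⟨h0, h1⟩
  have hne : σ * r ≠ 1 := by
    have : σ * r ≤ σ * 1 := mul_le_mul_of_nonneg_left hr1.le h0.le
    linarith
  simp only [Function.comp_apply]
  rw [uProf_eq_uCore hne]

/-- **Every leaf value is recovered along the scaling path, up to `δ`**: for `0 ≤ r ≤ 1`, `0 ≤ z`, `δ > 0`, eventually
(`σ → 1⁻`) `uProf λ r z − δ ≤ uProf λ (σr) (σ²z)`.  Interior leaves by continuity; sphere leaves: `u = 0` trivially,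
`z > λ` through `D₄` (`u = 1` eventually), `z = λ` through `D₂` (`uProf_corner`). [ours; elementary] -/
theorem uProf_path_eventually_ge {lam r z : ℝ} (hlam : 2 < lam) (hr0 : 0 ≤ r) (hr1 : r ≤ 1) (hz : 0 ≤ z)
    {δ : ℝ} (hδ : 0 < δ) :
    ∀ᶠ σ in 𝓝[<] (1 : ℝ), uProf lam r z - δ ≤ uProf lam (σ * r) (σ ^ 2 * z) := by
  rcases lt_or_eq_of_le hr1 with hr1' | hr1'
  · have ht := tendsto_uProf_path hlam hr0 hr1' hz
    exact (ht.eventually_const_lt (by linarith : uProf lam r z - δ < uProf lam r z)).mono fun σ h => h.le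
  · subst hr1'
    simp only [mul_one]
    rcases lt_trichotomy z lam with hzl | hzl | hzl
    · rw [uProf_one_of_lt hzl]
      filter_upwards [eventually_path_mem] with σ ⟨h0, h1⟩
      have := uProf_nonneg hlam h0.le h1.le (by positivity : 0 ≤ σ ^ 2 * z)
      linarith
    · subst hzl
      rw [uProf_one_of_le le_rfl]
      have hl : 0 < z := by linarith
      have hev2 : ∀ᶠ σ in 𝓝[<] (1 : ℝ), 1 - 1 / z < σ :=
        (eventually_gt_nhds (by
          have : 0 < 1 / z := by positivity
          linarith)).filter_mono nhdsWithin_le_nhds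
      have hg : Tendsto (fun σ : ℝ => 1 / (z ^ 2 * (1 - σ ^ 2) + 1)) (𝓝[<] (1 : ℝ)) (𝓝 1) := by
        have hcont : ContinuousAt (fun σ : ℝ => 1 / (z ^ 2 * (1 - σ ^ 2) + 1)) 1 :=
          ContinuousAt.div (by fun_prop) (by fun_prop) (by norm_num)
        have := hcont.tendsto
        simp only [one_pow, sub_self, mul_zero, zero_add, div_one] at this
        exact this.mono_left nhdsWithin_le_nhds
      have hev3 := hg.eventually_const_lt (show (1 : ℝ) - δ < 1 by linarith)
      filter_upwards [eventually_path_mem, hev2, hev3] with σ ⟨h0, h1⟩ h2 h3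
      rw [uProf_corner hlam h0 h1 h2.le]
      exact h3.le
    · rw [uProf_one_of_le hzl.le]
      have hg : Tendsto (fun σ : ℝ => σ ^ 4 * z ^ 2 - (lam ^ 2 - 1 + σ ^ 2)) (𝓝[<] (1 : ℝ))
          (𝓝 (z ^ 2 - lam ^ 2)) := by
        have hcont : Continuous (fun σ : ℝ => σ ^ 4 * z ^ 2 - (lam ^ 2 - 1 + σ ^ 2)) := by fun_prop
        have := hcont.tendsto 1
        have hval : (1 : ℝ) ^ 4 * z ^ 2 - (lam ^ 2 - 1 + 1 ^ 2) = z ^ 2 - lam ^ 2 := by ring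
        rw [hval] at this
        exact this.mono_left nhdsWithin_le_nhds
      have hpos : 0 < z ^ 2 - lam ^ 2 := by nlinarith
      have hev3 := hg.eventually_const_lt hpos
      filter_upwards [eventually_path_mem, hev3] with σ ⟨h0, h1⟩ h3
      have hD4 : lam ^ 2 - 1 + σ ^ 2 < (σ ^ 2 * z) ^ 2 := by nlinarith
      have hu : uProf lam σ (σ ^ 2 * z) = 1 := by
        unfold uProf; rw [if_neg h1.ne, if_pos hD4]
      rw [hu]; linarith

end Burk

end Summit.NavierStokesRegularity.FunctionalMining

end
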